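import Summits.QuantumFields.GaugeBoot.DiagonalRPTorusOddAction
import Summits.QuantumFields.GaugeBoot.DiagonalRPTorusTwoZigzagAverage
import HarnessLib

/-!
# Diagonal RP on the ODD two-dimensional torus, III: measure preservation, the layer-`c` average
and the averaged layer weight (gauge-boot, task L3(θ))

HONEST FRAMING (cell `pub-gaugeboot`, page 1 of every file): the venture produces certified bounds
on lattice expectations at stated coupling, gauge group, dimension and torus size; NOT a mass gap,
NOT a continuum limit, NOT a string tension; NOT Yang–Mills-summit-bearing (barriers
`FixedCouplingUltralocality`, `PerturbativeInvisibility`). This module is part of a small POSITIVE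
structural result about which positivity constraints a two-dimensional TORUS certificate may use
(no two-dimensional certificate with a diagonal block exists or is planned); it discharges nothing
else.

Continuation of `DiagonalRPTorusOddZigzag.lean` / `DiagonalRPTorusOddAction.lean` (notation there:
odd `L = 2c + 1 ≥ 3`, the middle zigzag `ZM`, the fibrewise vertex action `zigM` with its layer-`c`
part `zigM (onB k)` and layer-`(c+1)` part `zigM (onC k)`, the swap off the zigzag `Θ″`).

* `measurePreserving_zigM` (block two-sided translation of the zigzag links,
  `measurePreserving_blockMul`), `measurePreserving_configOddSwap` (relabelling by an involution),
  `measurePreserving_comp_siteDiagSwap` (relabelling site functions by `θ`), joint measurability of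
  the layer-`c` action (`measurable_zigM_onB`).
* `oavg i j g U = ∫ g (zigM (onB k) U) dk` — the average over the layer-`c` action (product Haar
  probability measure `siteMeasure` on site functions), with the Fubini identity
  `∫ (oavg g) Φ dU = ∫ g Φ dU` for bounded measurable `Φ` invariant under that action
  (`integral_oavg_mul`) and the invariances `oavg_zigM_onB` (by construction), `oavg_zigM_onC`
  (inherited), `oavg_zigM` (under every fibrewise vertex action).
* The layer-`c` Boltzmann weight `A = exp(β Σ_{k(y)=c} r_y)` (`layerW`) and its average `Ā`
  (`layerAvg`): `Ā` is invariant under EVERY fibrewise vertex action of the middle zigzag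
  (`layerAvg_zigM`), hence — the swap being `Θ″` followed by such an action
  (`configDiagSwap_eq_zigM_configOddSwap`) — **`Ā ∘ Θ = Ā ∘ Θ″`** (`layerAvg_configDiagSwap`);
  `Ā` is real, bounded, measurable and reads only links of the closed half and of the zigzag.

Continued in `DiagonalRPTorusOddCrossing.lean` and `DiagonalRPTorusOdd.lean`. All statements are
elementary and proved (Fubini over product Haar measure; E. Seiler, LNP 159 (1982) Ch. 2 for the
change of variables).
-/

open MeasureTheory Complex Finset Function
open scoped ComplexOrder ENNReal

namespace Summit.QuantumFields.GaugeBoot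

open Literature.MathematicalPhysics.QuantumFieldTheory

noncomputable section

namespace DiagRPTwo

/-! ## Measure preservation and measurability -/

section Measure

variable {L : ℕ} [NeZero L] {i j : Fin 2} {G : Type*} [Group G] [TopologicalSpace G]
  [IsTopologicalGroup G] [CompactSpace G] [MeasurableSpace G] [BorelSpace G]
  [SecondCountableTopology G]

/-- **The fibrewise action preserves product Haar measure** (a block two-sided translation of the
zigzag links by constants). -/
theorem measurePreserving_zigM (h : Site 2 L → G) :
    MeasurePreserving (zigM (G := G) i j h) (linkMeasure L G) (linkMeasure L G) := by
  classical
  have hm := measurePreserving_blockMul (G := G) (Finset.univ.filter (ZM (L := L) i j))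
    (fun e _ => h e.1) (fun e _ => (h (e.1.shift e.2))⁻¹) (fun _ => measurable_const)
    (fun _ => measurable_const) (fun _ => by intro U V _; rfl) (fun _ => by intro U V _; rfl)
  convert hm using 2 with U
  funext e
  by_cases he : ZM i j e
  · rw [zigM_apply_of_zm _ _ he, if_pos (Finset.mem_filter.2 ⟨Finset.mem_univ _, he⟩)]
  · rw [zigM_apply_of_not_zm _ _ he, if_neg fun hm => he (Finset.mem_filter.1 hm).2]

omit [SecondCountableTopology G] in
/-- `Θ″` preserves product Haar measure (odd `L`). -/
theorem measurePreserving_configOddSwap (hL : Odd L) (hij : i ≠ j) :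
    MeasurePreserving (configOddSwap (G := G) (L := L) i j) (linkMeasure L G) (linkMeasure L G) :=
  measurePreserving_comp_involutive (σ := oddSigma i j) (fun e => oddSigma_oddSigma hL hij e) _

omit [SecondCountableTopology G] in
/-- Relabelling the sites by the swap preserves the averaging measure. -/
theorem measurePreserving_comp_siteDiagSwap :
    MeasurePreserving (fun k : Site 2 L → G => k ∘ siteDiagSwap i j) (siteMeasure L G)
      (siteMeasure L G) := by
  have hσ : Function.Involutive (siteDiagSwap (L := L) i j) := siteDiagSwap_siteDiagSwap i j
  have h := MeasureTheory.measurePreserving_piCongrLeft (fun _ : Site 2 L => haarProbability G)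
    (hσ.toPerm _)
  rw [coe_piCongrLeft_site hσ] at h
  exact h

omit [NeZero L] [TopologicalSpace G] [IsTopologicalGroup G] [CompactSpace G] [BorelSpace G]
  [SecondCountableTopology G] in
/-- `k ↦ onB k y` is measurable. -/
theorem measurable_onB_apply (y : Site 2 L) : Measurable fun k : Site 2 L → G => onB i j k y := by
  by_cases hy : kd i j y = cc L
  · have h1 : (fun k : Site 2 L → G => onB i j k y) = fun k => k y := funext fun k => onB_of_eq k hy
    rw [h1]
    exact measurable_pi_apply (X := fun _ : Site 2 L => G) y
  · have h1 : (fun k : Site 2 L → G => onB i j k y) = fun _ => 1 := funext fun k => onB_of_ne k hy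
    rw [h1]
    exact measurable_const

omit [NeZero L] [TopologicalSpace G] [IsTopologicalGroup G] [CompactSpace G] [BorelSpace G]
  [SecondCountableTopology G] in
/-- The layer-`c` action is jointly measurable in the site function and the configuration. -/
theorem measurable_zigM_onB [MeasurableMul₂ G] [MeasurableInv G] :
    Measurable fun p : (Site 2 L → G) × GaugeConfig 2 L G => zigM i j (onB i j p.1) p.2 := by
  refine measurable_pi_lambda _ fun e => ?_
  by_cases he : ZM i j e
  · have h1 : (fun p : (Site 2 L → G) × GaugeConfig 2 L G => zigM i j (onB i j p.1) p.2 e) =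
        fun p => onB i j p.1 e.1 * p.2 e * (onB i j p.1 (e.1.shift e.2))⁻¹ :=
      funext fun p => zigM_apply_of_zm _ _ he
    rw [h1]
    have hU : Measurable fun p : (Site 2 L → G) × GaugeConfig 2 L G => p.2 e :=
      (measurable_pi_apply (X := fun _ : Edge 2 L => G) e).comp measurable_snd
    exact (((measurable_onB_apply _).comp measurable_fst).mul hU).mul
      ((measurable_onB_apply _).comp measurable_fst).inv
  · have h1 : (fun p : (Site 2 L → G) × GaugeConfig 2 L G => zigM i j (onB i j p.1) p.2 e) =
        fun p => p.2 e := funext fun p => zigM_apply_of_not_zm _ _ he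
    rw [h1]
    exact (measurable_pi_apply (X := fun _ : Edge 2 L => G) e).comp measurable_snd

omit [NeZero L] [TopologicalSpace G] [IsTopologicalGroup G] [CompactSpace G] [BorelSpace G]
  [SecondCountableTopology G] in
/-- The layer-`c` action is measurable in the site function. -/
theorem measurable_zigM_onB_left [MeasurableMul₂ G] [MeasurableInv G] (U : GaugeConfig 2 L G) :
    Measurable fun k : Site 2 L → G => zigM i j (onB i j k) U :=
  measurable_zigM_onB.comp (measurable_id.prodMk measurable_const)

end Measure

/-! ## The layer-`c` average -/

section Average

variable {L : ℕ} [NeZero L] {i j : Fin 2} {G : Type*} [Group G] [TopologicalSpace G]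
  [IsTopologicalGroup G] [CompactSpace G] [MeasurableSpace G] [BorelSpace G]
  [SecondCountableTopology G]

variable (i j) in
/-- The average of `g` over the layer-`c` action: `(oavg g)(U) = ∫ g(zigM (onB k) U) dk`. -/
def oavg (g : GaugeConfig 2 L G → ℂ) (U : GaugeConfig 2 L G) : ℂ :=
  ∫ k, g (zigM i j (onB i j k) U) ∂(siteMeasure L G)

omit [SecondCountableTopology G] in
/-- The average is bounded by the bound of `g`. -/
theorem norm_oavg_le {g : GaugeConfig 2 L G → ℂ} {C : ℝ} (hgb : ∀ U, ‖g U‖ ≤ C)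
    (U : GaugeConfig 2 L G) : ‖oavg i j g U‖ ≤ C := by
  have h := norm_integral_le_of_norm_le_const (μ := siteMeasure L G)
    (f := fun k : Site 2 L → G => g (zigM i j (onB i j k) U)) (Filter.Eventually.of_forall fun k => hgb _)
  rwa [probReal_univ, mul_one] at h

/-- The average is measurable. -/
theorem measurable_oavg {g : GaugeConfig 2 L G → ℂ} (hg : Measurable g) : Measurable (oavg i j g) := by
  have hsm : StronglyMeasurable fun p : (Site 2 L → G) × GaugeConfig 2 L G =>
      g (zigM i j (onB i j p.1) p.2) := (hg.comp measurable_zigM_onB).stronglyMeasurable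
  exact (MeasureTheory.StronglyMeasurable.integral_prod_left' (μ := siteMeasure L G) hsm).measurable

omit [SecondCountableTopology G] in
/-- The average of a function of a set of links is a function of the same links. -/
theorem dependsOn_oavg {g : GaugeConfig 2 L G → ℂ} {S : Set (Edge 2 L)} (hg : DependsOn g S) :
    DependsOn (oavg i j g) S := by
  intro U V hUV
  unfold oavg
  exact integral_congr_ae (Filter.Eventually.of_forall fun k => dependsOn_comp_zigM hg _ hUV)

omit [SecondCountableTopology G] in
/-- The average of a real-valued function is real. -/
theorem conj_oavg_ofReal (f : GaugeConfig 2 L G → ℝ) (U : GaugeConfig 2 L G) :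
    (starRingEnd ℂ) (oavg i j (fun V => (f V : ℂ)) U) = oavg i j (fun V => (f V : ℂ)) U := by
  have h : oavg i j (fun V => (f V : ℂ)) U =
      ((∫ k, f (zigM i j (onB i j k) U) ∂(siteMeasure L G) : ℝ) : ℂ) := by
    unfold oavg
    exact integral_complex_ofReal
  rw [h, Complex.conj_ofReal]

/-- **Fubini identity of the average**: `∫ (oavg g) Φ dU = ∫ g Φ dU` for every bounded measurable
`Φ` invariant under the layer-`c` action. -/
theorem integral_oavg_mul {g Φ : GaugeConfig 2 L G → ℂ} (hg : Measurable g) {Cg : ℝ}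
    (hgb : ∀ U, ‖g U‖ ≤ Cg) (hΦ : Measurable Φ) {CΦ : ℝ} (hΦb : ∀ U, ‖Φ U‖ ≤ CΦ)
    (hΦz : ∀ k U, Φ (zigM i j (onB i j k) U) = Φ U) :
    ∫ U, oavg i j g U * Φ U ∂(linkMeasure L G) = ∫ U, g U * Φ U ∂(linkMeasure L G) := by
  have h1 : ∀ U, oavg i j g U * Φ U =
      ∫ k, g (zigM i j (onB i j k) U) * Φ U ∂(siteMeasure L G) := fun U =>
    (integral_mul_const (Φ U) _).symm
  simp_rw [h1]
  have hint : Integrable (Function.uncurry fun (U : GaugeConfig 2 L G) (k : Site 2 L → G) =>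
      g (zigM i j (onB i j k) U) * Φ U) ((linkMeasure L G).prod (siteMeasure L G)) := by
    have hm : Measurable (Function.uncurry fun (U : GaugeConfig 2 L G) (k : Site 2 L → G) =>
        g (zigM i j (onB i j k) U) * Φ U) :=
      (hg.comp (measurable_zigM_onB.comp (measurable_snd.prodMk measurable_fst))).mul
        (hΦ.comp measurable_fst)
    refine Integrable.of_bound hm.aestronglyMeasurable (Cg * CΦ) (Filter.Eventually.of_forall ?_)
    rintro ⟨U, k⟩
    simp only [Function.uncurry_apply_pair, norm_mul]
    exact mul_le_mul (hgb _) (hΦb _) (norm_nonneg _) ((norm_nonneg _).trans (hgb U))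
  rw [integral_integral_swap hint]
  have h2 : ∀ k : Site 2 L → G, ∫ U, g (zigM i j (onB i j k) U) * Φ U ∂(linkMeasure L G) =
      ∫ U, g U * Φ U ∂(linkMeasure L G) := fun k => by
    have h := LatticeRP.integral_comp_eq_of_measurePreserving
      (measurePreserving_zigM (i := i) (j := j) (onB i j k))
      (Φ := fun U => g U * Φ U) (hg.mul hΦ)
    simp only [hΦz] at h
    exact h
  simp_rw [h2]
  rw [integral_const, probReal_univ, one_smul]

/-- The average is invariant under the layer-`c` action (right invariance of Haar measure). -/
theorem oavg_zigM_onB {g : GaugeConfig 2 L G → ℂ} (hg : Measurable g) (h : Site 2 L → G)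
    (U : GaugeConfig 2 L G) : oavg i j g (zigM i j (onB i j h) U) = oavg i j g U := by
  unfold oavg
  have h1 : ∀ k, g (zigM i j (onB i j k) (zigM i j (onB i j h) U)) =
      g (zigM i j (onB i j (k * h)) U) := fun k => by rw [onB_mul, zigM_mul]
  simp_rw [h1]
  exact LatticeRP.integral_comp_eq_of_measurePreserving (measurePreserving_mul_site h)
    (Φ := fun k => g (zigM i j (onB i j k) U)) (hg.comp (measurable_zigM_onB_left U))

omit [SecondCountableTopology G] in
/-- The average inherits invariance under the layer-`(c+1)` action (`L ≥ 3`). -/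
theorem oavg_zigM_onC (h3 : 3 ≤ L) {g : GaugeConfig 2 L G → ℂ}
    (hgC : ∀ k U, g (zigM i j (onC i j k) U) = g U) (k' : Site 2 L → G) (U : GaugeConfig 2 L G) :
    oavg i j g (zigM i j (onC i j k') U) = oavg i j g U := by
  unfold oavg
  exact integral_congr_ae (Filter.Eventually.of_forall fun k => by
    simp only [zigM_onB_onC_comm h3, hgC])

/-- **The average of a layer-`(c+1)`-invariant function is invariant under EVERY fibrewise vertex
action of the middle zigzag** (`L ≥ 3`). -/
theorem oavg_zigM (h3 : 3 ≤ L) (hij : i ≠ j) {g : GaugeConfig 2 L G → ℂ} (hg : Measurable g)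
    (hgC : ∀ k U, g (zigM i j (onC i j k) U) = g U) (h : Site 2 L → G) (U : GaugeConfig 2 L G) :
    oavg i j g (zigM i j h U) = oavg i j g U := by
  rw [zigM_eq_zigM_onB_onC h3 hij, oavg_zigM_onB hg, oavg_zigM_onC h3 hgC]

end Average

/-! ## The layer-`c` Boltzmann weight and its average -/

section Layer

variable {L N : ℕ} [NeZero L] {G : Type*} [Group G] [TopologicalSpace G]
  [IsTopologicalGroup G] [CompactSpace G] [MeasurableSpace G] [BorelSpace G]
  [SecondCountableTopology G] (ρ : G →* Matrix (Fin N) (Fin N) ℂ) {i j : Fin 2}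

variable (i j) in
/-- The Boltzmann weight of the layer-`c` plaquettes, `A(U) = exp(β Σ_{k(y)=c} r_y(U))`. -/
def layerW (β : ℝ) (U : GaugeConfig 2 L G) : ℝ := Real.exp (β * ∑ y ∈ Sc i j, rr ρ i j U y)

variable (i j) in
/-- The averaged layer weight `Ā = oavg A` (a complex-valued, in fact real, function). -/
def layerAvg (β : ℝ) (U : GaugeConfig 2 L G) : ℂ :=
  oavg i j (fun V => (layerW ρ i j β V : ℂ)) U

omit [TopologicalSpace G] [IsTopologicalGroup G] [CompactSpace G] [MeasurableSpace G] [BorelSpace G]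
  [SecondCountableTopology G] in
/-- `0 < A`. -/
theorem layerW_pos (β : ℝ) (U : GaugeConfig 2 L G) : 0 < layerW ρ i j β U := Real.exp_pos _

omit [MeasurableSpace G] [BorelSpace G] [SecondCountableTopology G] in
/-- `A ≤ exp(|β| |Sc| N)`. -/
theorem layerW_le (hρ : Continuous ρ) (β : ℝ) (U : GaugeConfig 2 L G) :
    layerW ρ i j β U ≤ Real.exp (|β| * ((Sc (L := L) i j).card * N)) := by
  refine Real.exp_le_exp.2 ?_
  calc β * ∑ y ∈ Sc i j, rr ρ i j U y ≤ |β * ∑ y ∈ Sc i j, rr ρ i j U y| := le_abs_self _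
    _ = |β| * |∑ y ∈ Sc i j, rr ρ i j U y| := abs_mul _ _
    _ ≤ |β| * ((Sc (L := L) i j).card * N) :=
        mul_le_mul_of_nonneg_left (abs_sum_rr_le ρ hρ i j _ U) (abs_nonneg β)

omit [MeasurableSpace G] [BorelSpace G] [SecondCountableTopology G] in
/-- `‖(A : ℂ)‖ ≤ exp(|β| |Sc| N)`. -/
theorem norm_layerW_le (hρ : Continuous ρ) (β : ℝ) (U : GaugeConfig 2 L G) :
    ‖(layerW ρ i j β U : ℂ)‖ ≤ Real.exp (|β| * ((Sc (L := L) i j).card * N)) := by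
  rw [Complex.norm_real, Real.norm_eq_abs, abs_of_pos (layerW_pos ρ β U)]
  exact layerW_le ρ hρ β U

omit [CompactSpace G] in
/-- `A` is measurable (as a complex-valued function). -/
theorem measurable_layerW (hρ : Continuous ρ) (β : ℝ) :
    Measurable fun U : GaugeConfig 2 L G => (layerW ρ i j β U : ℂ) :=
  Complex.measurable_ofReal.comp
    ((Finset.measurable_sum _ fun y _ => measurable_rr ρ hρ i j y).const_mul β).exp

omit [TopologicalSpace G] [IsTopologicalGroup G] [CompactSpace G] [MeasurableSpace G] [BorelSpace G]
  [SecondCountableTopology G] in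
/-- `A` reads only links of the closed half and of the zigzag (`L ≥ 3`). -/
theorem dependsOn_layerW (h3 : 3 ≤ L) (hij : i ≠ j) (β : ℝ) :
    DependsOn (fun U : GaugeConfig 2 L G => (layerW ρ i j β U : ℂ))
      ((halfLinks i j ∪ zmLinks (L := L) i j : Finset (Edge 2 L)) : Set (Edge 2 L)) := by
  intro U V hUV
  have hS : ∑ y ∈ Sc i j, rr ρ i j U y = ∑ y ∈ Sc i j, rr ρ i j V y :=
    dependsOn_sum_rr ρ i j (Sc i j) fun e he => hUV e (by
      obtain ⟨y, hy, hey⟩ := Finset.mem_biUnion.1 he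
      exact blk_subset_of_kd_eq_cc h3 hij ((kd_eq_cc_iff' y).2 (mem_Sc.1 hy)) (Finset.mem_coe.2 hey))
  simp only [layerW, hS]

omit [TopologicalSpace G] [IsTopologicalGroup G] [CompactSpace G] [MeasurableSpace G] [BorelSpace G]
  [SecondCountableTopology G] in
/-- **`A` is invariant under the layer-`(c+1)` action** (`L ≥ 3`). -/
theorem layerW_zigM_onC (h3 : 3 ≤ L) (hij : i ≠ j) (β : ℝ) (k : Site 2 L → G)
    (U : GaugeConfig 2 L G) : layerW ρ i j β (zigM i j (onC i j k) U) = layerW ρ i j β U := by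
  have hS : ∑ y ∈ Sc i j, rr ρ i j (zigM i j (onC i j k) U) y = ∑ y ∈ Sc i j, rr ρ i j U y :=
    Finset.sum_congr rfl fun y hy =>
      rr_zigM_onC_of_kd_eq_cc ρ h3 hij k U ((kd_eq_cc_iff' y).2 (mem_Sc.1 hy))
  rw [layerW, layerW, hS]

omit [TopologicalSpace G] [IsTopologicalGroup G] [CompactSpace G] [MeasurableSpace G] [BorelSpace G]
  [SecondCountableTopology G] in
/-- `A ∘ Θ` is invariant under the layer-`c` action (odd `L ≥ 3`): the swap conjugates the
layer-`c` action into the layer-`(c+1)` action. -/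
theorem layerW_configDiagSwap_zigM_onB (hL : Odd L) (h3 : 3 ≤ L) (hij : i ≠ j) (β : ℝ)
    (k : Site 2 L → G) (U : GaugeConfig 2 L G) :
    layerW ρ i j β (configDiagSwap i j (zigM i j (onB i j k) U)) =
      layerW ρ i j β (configDiagSwap i j U) := by
  rw [configDiagSwap_zigM hL hij, ← onC_comp_siteDiagSwap hL, layerW_zigM_onC ρ h3 hij]

omit [SecondCountableTopology G] in
/-- `Ā` is real. -/
theorem conj_layerAvg (β : ℝ) (U : GaugeConfig 2 L G) :
    (starRingEnd ℂ) (layerAvg ρ i j β U) = layerAvg ρ i j β U :=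
  conj_oavg_ofReal _ U

omit [SecondCountableTopology G] in
/-- `‖Ā‖ ≤ exp(|β| |Sc| N)`. -/
theorem norm_layerAvg_le (hρ : Continuous ρ) (β : ℝ) (U : GaugeConfig 2 L G) :
    ‖layerAvg ρ i j β U‖ ≤ Real.exp (|β| * ((Sc (L := L) i j).card * N)) :=
  norm_oavg_le (norm_layerW_le ρ hρ β) U

/-- `Ā` is measurable. -/
theorem measurable_layerAvg (hρ : Continuous ρ) (β : ℝ) :
    Measurable (layerAvg (G := G) (L := L) ρ i j β) :=
  measurable_oavg (measurable_layerW ρ hρ β)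

omit [SecondCountableTopology G] in
/-- `Ā` reads only links of the closed half and of the zigzag (`L ≥ 3`). -/
theorem dependsOn_layerAvg (h3 : 3 ≤ L) (hij : i ≠ j) (β : ℝ) :
    DependsOn (layerAvg (G := G) ρ i j β)
      ((halfLinks i j ∪ zmLinks (L := L) i j : Finset (Edge 2 L)) : Set (Edge 2 L)) :=
  dependsOn_oavg (dependsOn_layerW ρ h3 hij β)

/-- **`Ā` is invariant under every fibrewise vertex action of the middle zigzag** (`L ≥ 3`). -/
theorem layerAvg_zigM (hρ : Continuous ρ) (h3 : 3 ≤ L) (hij : i ≠ j) (β : ℝ) (h : Site 2 L → G)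
    (U : GaugeConfig 2 L G) : layerAvg ρ i j β (zigM i j h U) = layerAvg ρ i j β U :=
  oavg_zigM h3 hij (measurable_layerW ρ hρ β)
    (fun k V => by rw [layerW_zigM_onC ρ h3 hij β k V]) h U

/-- `Ā ∘ Θ` is invariant under the layer-`c` action (odd `L ≥ 3`). -/
theorem layerAvg_configDiagSwap_zigM_onB (hρ : Continuous ρ) (hL : Odd L) (h3 : 3 ≤ L)
    (hij : i ≠ j) (β : ℝ) (k : Site 2 L → G) (U : GaugeConfig 2 L G) :
    layerAvg ρ i j β (configDiagSwap i j (zigM i j (onB i j k) U)) =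
      layerAvg ρ i j β (configDiagSwap i j U) := by
  rw [configDiagSwap_zigM hL hij, layerAvg_zigM ρ hρ h3 hij]

/-- **`Ā ∘ Θ = Ā ∘ Θ″`** (odd `L ≥ 3`): the swap is `Θ″` followed by a fibrewise vertex action of
the middle zigzag, which `Ā` does not see. -/
theorem layerAvg_configDiagSwap (hρ : Continuous ρ) (hL : Odd L) (h3 : 3 ≤ L) (hij : i ≠ j)
    (β : ℝ) (U : GaugeConfig 2 L G) :
    layerAvg ρ i j β (configDiagSwap i j U) = layerAvg ρ i j β (configOddSwap i j U) := by
  rw [configDiagSwap_eq_zigM_configOddSwap hL h3 hij U, layerAvg_zigM ρ hρ h3 hij]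

end Layer

end DiagRPTwo

end

end Summit.QuantumFields.GaugeBoot
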